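import Mathlib.Analysis.AbsoluteValue.Equivalence
import Mathlib.NumberTheory.NumberField.InfinitePlace.Basic
import Literature.NumberTheory.GaloisRepresentations.DecompositionGroupOfCompletion
import HarnessLib

/-!
# Embeddings into `\bar K_v`: density and simultaneous approximation

Topic `NumberTheory/GaloisRepresentations`; theorems only (no definition, no named fact), in the
setting of `DecompositionGroupOfCompletion`: `K` a number field, `v` a finite place,
`K_v = v.adicCompletion K` with its `v`-adic norm, `\bar K_v = AlgebraicClosure K_v` with the spectral
norm `|·|_v = spectralNorm K_v \bar K_v` (the unique extension of the norm of `K_v`).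

For a finite extension `E / K` and a `K`-embedding `φ : E → \bar K_v` we record the two classical
approximation statements used to *construct global elements with prescribed local behaviour*
(Artin–Whaples; the engine of the existence of number fields with prescribed local behaviour, e.g.
Clozel–Harris–Taylor 2008, Lemma 4.1.2, whose CFT-free proof in
`NumberFields/SolubleCMExtensionPrescribedLocal` consumes this file):

* `exists_spectralNorm_sub_lt_of_mem_adjoin` — **`φ(E)` is dense in the completion
  `K_v · φ(E) = E_w`** (`IntermediateField.adjoin K_v (range φ)`): every `y ∈ K_v(φ(E))` is
  `|·|_v`-approximated by elements `φ t`, `t ∈ E` (from the density of `K` in `K_v`).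
* `exists_absoluteValue_eq_spectralNorm` — `x ↦ |φ x|_v` is an absolute value of `E` (the place `w`
  of `E` above `v` defined by `φ`); it is non-trivial (`isNontrivial_of_forall_eq_spectralNorm`), two
  of them at the same `v` are equivalent only if equal (`eq_of_isEquiv_of_forall_eq_spectralNorm`),
  at different `v ≠ v'` they are inequivalent (`not_isEquiv_of_ne`), and they are inequivalent to
  every archimedean absolute value (`not_isEquiv_of_one_lt`); two real embeddings with equivalent
  absolute values are equal (`ringHom_real_eq_of_isEquiv`).
* `exists_forall_spectralNorm_sub_lt` — **simultaneous approximation**: given finitely many finite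
  places `S`, targets `t v φ ∈ E` for every `v ∈ S` and every `K`-embedding `φ : E → \bar K_v`
  (consistent on embeddings defining the same absolute value), and real targets `r σ` for the real
  embeddings `σ : E → ℝ`, there is one `x ∈ E` with `|φ (x - t v φ)|_v < ε` for all `v ∈ S`, all `φ`,
  and `|σ (x - r σ)| < ε` for all real `σ` — Mathlib's abstract weak approximation theorem
  `AbsoluteValue.denseRange_algebraMap_pi` applied to this family.

## References

* E. Artin, G. Whaples, *Axiomatic characterization of fields by the product formula for
  valuations*, Bull. AMS 51 (1945), Thm. 1 (approximation theorem). [folklore]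
* J. Neukirch, *Algebraic Number Theory*, Grundlehren 322 (1999), Ch. II (3.4) (approximation
  theorem), Ch. II (8.1)–(8.3) (extensions of valuations ↔ embeddings into `\bar K_v`,
  `L_w = L K_v`). [NeukirchANT1999]
* L. Clozel, M. Harris, R. Taylor, Publ. Math. IHÉS 108 (2008), Lemma 4.1.2 (the consumer).
  [ClozelHarrisTaylor2008]
-/

noncomputable section

open scoped NumberField Valued
open IsDedekindDomain

universe u

namespace Literature.NumberTheory.GaloisRepresentations

variable (K : Type u) [Field K] [NumberField K] (v : HeightOneSpectrum (𝓞 K))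

/-! ### Density of `φ(E)` in `K_v(φ(E))` -/

/-- **`φ(E)` is dense in `E_w = K_v(φ(E))`.**  For a finite extension `E/K`, a `K`-embedding
`φ : E → \bar K_v` and `y` in the compositum `K_v(φ(E)) ⊆ \bar K_v` (a model of the completion of
`E` at the place `w` defined by `φ`), `y` is approximated in the spectral norm by elements of
`φ(E)`: `K_v(φ(E))` is the `K_v`-span of `φ(E)` and `K` is dense in `K_v`.
Neukirch, *Algebraic Number Theory*, Ch. II (8.3) (`L_w = L K_v`, `L` dense in `L_w`).
[cite: NeukirchANT1999, Ch. II (8.3)] -/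
theorem exists_spectralNorm_sub_lt_of_mem_adjoin {E : Type*} [Field E] [Algebra K E]
    (φ : E →ₐ[K] AlgebraicClosure (v.adicCompletion K))
    {y : AlgebraicClosure (v.adicCompletion K)}
    (hy : y ∈ IntermediateField.adjoin (v.adicCompletion K) (Set.range φ)) {ε : ℝ} (hε : 0 < ε) :
    ∃ t : E, spectralNorm (v.adicCompletion K) (AlgebraicClosure (v.adicCompletion K))
      (φ t - y) < ε := by
  classical
  have halg : ∀ x ∈ Set.range φ, IsAlgebraic (v.adicCompletion K) x := fun x _ =>
    Algebra.IsAlgebraic.isAlgebraic x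
  have hy' : y ∈ Submodule.span (v.adicCompletion K) (Set.range φ) := by
    have h1 : y ∈ (IntermediateField.adjoin (v.adicCompletion K) (Set.range φ)).toSubalgebra := hy
    rw [IntermediateField.adjoin_toSubalgebra_of_isAlgebraic halg] at h1
    have h2 : y ∈ Subalgebra.toSubmodule (Algebra.adjoin (v.adicCompletion K) (Set.range φ)) := h1
    rw [Algebra.adjoin_eq_span] at h2
    rwa [show ((Submonoid.closure (Set.range φ) : Submonoid (AlgebraicClosure (v.adicCompletion K)))
        : Set (AlgebraicClosure (v.adicCompletion K))) = Set.range φ from by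
      rw [show Set.range φ = ((MonoidHom.mrange (φ : E →* AlgebraicClosure (v.adicCompletion K)))
          : Set (AlgebraicClosure (v.adicCompletion K))) from (MonoidHom.coe_mrange _).symm,
        Submonoid.closure_eq]] at h2
  clear hy halg
  induction hy' using Submodule.span_induction generalizing ε with
  | mem x hx =>
      obtain ⟨t, rfl⟩ := hx
      exact ⟨t, by simpa [spectralNorm_zero] using hε⟩
  | zero => exact ⟨0, by simpa [spectralNorm_zero] using hε⟩
  | add x y _ _ ihx ihy =>
      obtain ⟨s, hs⟩ := ihx hε
      obtain ⟨t, ht⟩ := ihy hε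
      refine ⟨s + t, ?_⟩
      calc spectralNorm (v.adicCompletion K) (AlgebraicClosure (v.adicCompletion K))
              (φ (s + t) - (x + y))
            = spectralNorm (v.adicCompletion K) (AlgebraicClosure (v.adicCompletion K))
              ((φ s - x) + (φ t - y)) := by rw [map_add]; congr 1; ring
        _ ≤ max (spectralNorm (v.adicCompletion K) (AlgebraicClosure (v.adicCompletion K))
              (φ s - x)) (spectralNorm (v.adicCompletion K) (AlgebraicClosure (v.adicCompletion K))
              (φ t - y)) := isNonarchimedean_spectralNorm _ _
        _ < ε := max_lt hs ht
  | smul c x _ ihx =>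
      set Nx := spectralNorm (v.adicCompletion K) (AlgebraicClosure (v.adicCompletion K)) x with hNx
      have hNx0 : 0 ≤ Nx := spectralNorm_nonneg _
      have hc1 : 0 < ‖c‖ + 1 := by positivity
      obtain ⟨t, ht⟩ := ihx (div_pos hε hc1)
      have hδ : 0 < min 1 (ε / (Nx + 1)) := lt_min one_pos (div_pos hε (by positivity))
      obtain ⟨c', hc'⟩ :=
        (HeightOneSpectrum.denseRange_algebraMap (K := K) (v := v)).exists_dist_lt c hδ
      rw [dist_eq_norm] at hc'
      set c'' := algebraMap K (v.adicCompletion K) c' with hc''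
      refine ⟨c' • t, ?_⟩
      have hsplit : φ (c' • t) - c • x = c'' • (φ t - x) + (c'' - c) • x := by
        rw [map_smul, ← algebraMap_smul (v.adicCompletion K) c' (φ t), ← hc'', smul_sub, sub_smul]
        abel
      have h1 : spectralNorm (v.adicCompletion K) (AlgebraicClosure (v.adicCompletion K))
          (c'' • (φ t - x)) < ε := by
        rw [spectralNorm_smul _ (Algebra.IsAlgebraic.isAlgebraic _)]
        have hcn : (‖c''‖₊ : ℝ) ≤ ‖c‖ + 1 := by
          rw [coe_nnnorm]
          calc ‖c''‖ = ‖c + (c'' - c)‖ := by congr 1; abel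
            _ ≤ ‖c‖ + ‖c'' - c‖ := norm_add_le _ _
            _ ≤ ‖c‖ + 1 := by
                rw [← norm_neg (c'' - c), neg_sub]
                exact add_le_add_right (hc'.le.trans (min_le_left _ _)) _
        calc (‖c''‖₊ : ℝ) * spectralNorm (v.adicCompletion K)
                (AlgebraicClosure (v.adicCompletion K)) (φ t - x)
              ≤ (‖c‖ + 1) * spectralNorm (v.adicCompletion K)
                (AlgebraicClosure (v.adicCompletion K)) (φ t - x) :=
                mul_le_mul_of_nonneg_right hcn (spectralNorm_nonneg _)
          _ < (‖c‖ + 1) * (ε / (‖c‖ + 1)) := mul_lt_mul_of_pos_left ht hc1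
          _ = ε := mul_div_cancel₀ ε hc1.ne'
      have h2 : spectralNorm (v.adicCompletion K) (AlgebraicClosure (v.adicCompletion K))
          ((c'' - c) • x) < ε := by
        rw [spectralNorm_smul _ (Algebra.IsAlgebraic.isAlgebraic _), coe_nnnorm, ← hNx]
        have hcc : ‖c'' - c‖ < ε / (Nx + 1) := by
          rw [← norm_neg (c'' - c), neg_sub]; exact hc'.trans_le (min_le_right _ _)
        calc ‖c'' - c‖ * Nx ≤ ε / (Nx + 1) * Nx := mul_le_mul_of_nonneg_right hcc.le hNx0
          _ < ε := by
              rw [div_mul_eq_mul_div, div_lt_iff₀ (by positivity)]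
              nlinarith
      rw [hsplit]
      exact (isNonarchimedean_spectralNorm _ _).trans_lt (max_lt h1 h2)

/-! ### The absolute values `x ↦ |φ x|_v` of `E` -/

/-- For a `K`-embedding `φ : E → \bar K_v`, `x ↦ |φ x|_v` (spectral norm) is an absolute value of
`E` — the place of `E` above `v` defined by `φ`.  Neukirch, *Algebraic Number Theory*, Ch. II
(8.1)–(8.2). [cite: NeukirchANT1999, Ch. II (8.1)] -/
theorem exists_absoluteValue_eq_spectralNorm {E : Type*} [Field E] [Algebra K E]
    (φ : E →ₐ[K] AlgebraicClosure (v.adicCompletion K)) :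
    ∃ w : AbsoluteValue E ℝ, ∀ x, w x =
      spectralNorm (v.adicCompletion K) (AlgebraicClosure (v.adicCompletion K)) (φ x) := by
  refine ⟨{ toFun := fun x =>
              spectralNorm (v.adicCompletion K) (AlgebraicClosure (v.adicCompletion K)) (φ x)
            map_mul' := fun x y => ?_
            nonneg' := fun x => spectralNorm_nonneg _
            eq_zero' := fun x => ?_
            add_le' := fun x y => ?_ }, fun x => rfl⟩
  · simp only [map_mul]
    rw [← spectralMulAlgNorm_def, ← spectralMulAlgNorm_def, ← spectralMulAlgNorm_def, map_mul]
  · refine ⟨fun h => ?_, fun h => by simp [h, spectralNorm_zero]⟩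
    exact (map_eq_zero φ).mp
      (eq_zero_of_map_spectralNorm_eq_zero h (Algebra.IsAlgebraic.isAlgebraic _))
  · simp only [map_add]
    exact (isNonarchimedean_spectralNorm _ _).trans
      (max_le_add_of_nonneg (spectralNorm_nonneg _) (spectralNorm_nonneg _))

variable {K v} in
/-- The absolute value `|φ ·|_v` restricted to `K` is the `v`-adic norm. [folklore] -/
theorem absoluteValue_algebraMap_of_forall_eq_spectralNorm {E : Type*} [Field E] [Algebra K E]
    {φ : E →ₐ[K] AlgebraicClosure (v.adicCompletion K)} {w : AbsoluteValue E ℝ}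
    (hw : ∀ x, w x =
      spectralNorm (v.adicCompletion K) (AlgebraicClosure (v.adicCompletion K)) (φ x)) (c : K) :
    w (algebraMap K E c) = ‖algebraMap K (v.adicCompletion K) c‖ := by
  rw [hw, AlgHom.commutes, IsScalarTower.algebraMap_apply K (v.adicCompletion K)
    (AlgebraicClosure (v.adicCompletion K)), spectralNorm_extends]

variable {K v} in
/-- `|φ ·|_v` is a non-trivial absolute value of `E` (it is `< 1` on a non-zero element of `v`).
[folklore] -/
theorem isNontrivial_of_forall_eq_spectralNorm {E : Type*} [Field E] [Algebra K E]
    {φ : E →ₐ[K] AlgebraicClosure (v.adicCompletion K)} {w : AbsoluteValue E ℝ}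
    (hw : ∀ x, w x =
      spectralNorm (v.adicCompletion K) (AlgebraicClosure (v.adicCompletion K)) (φ x)) :
    w.IsNontrivial := by
  obtain ⟨c, hc0, hc1⟩ := exists_norm_algebraMap_adicCompletion_lt_one K v
  refine ⟨algebraMap K E c, fun h => ?_, ?_⟩
  · have : w (algebraMap K E c) = 0 := by rw [h, map_zero]
    rw [absoluteValue_algebraMap_of_forall_eq_spectralNorm hw] at this
    exact hc0.ne' this
  · rw [absoluteValue_algebraMap_of_forall_eq_spectralNorm hw]
    exact hc1.ne

variable {K v} in
/-- Two embeddings `φ, ψ : E → \bar K_v` at the **same** place `v` define *equivalent* absolute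
values only if they define *equal* ones (both restrict to `|·|_v` on `K`, which takes a value in
`(0, 1)`). [folklore] -/
theorem eq_of_isEquiv_of_forall_eq_spectralNorm {E : Type*} [Field E] [Algebra K E]
    {φ ψ : E →ₐ[K] AlgebraicClosure (v.adicCompletion K)} {w₁ w₂ : AbsoluteValue E ℝ}
    (hw₁ : ∀ x, w₁ x =
      spectralNorm (v.adicCompletion K) (AlgebraicClosure (v.adicCompletion K)) (φ x))
    (hw₂ : ∀ x, w₂ x =
      spectralNorm (v.adicCompletion K) (AlgebraicClosure (v.adicCompletion K)) (ψ x))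
    (h : w₁.IsEquiv w₂) : w₁ = w₂ := by
  obtain ⟨c, _, hcw⟩ := AbsoluteValue.isEquiv_iff_exists_rpow_eq.1 h
  obtain ⟨k, hk0, hk1⟩ := exists_norm_algebraMap_adicCompletion_lt_one K v
  have hc1 : c = 1 := by
    have hk : w₁ (algebraMap K E k) ^ c = w₂ (algebraMap K E k) := congr_fun hcw (algebraMap K E k)
    rw [absoluteValue_algebraMap_of_forall_eq_spectralNorm hw₁,
      absoluteValue_algebraMap_of_forall_eq_spectralNorm hw₂] at hk
    exact (Real.rpow_right_inj hk0 hk1.ne).1 (hk.trans (Real.rpow_one _).symm)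
  ext x
  have hx : w₁ x ^ c = w₂ x := congr_fun hcw x
  rwa [hc1, Real.rpow_one] at hx

variable {K} in
/-- Embeddings `φ : E → \bar K_v`, `ψ : E → \bar K_{v'}` at **different** places `v ≠ v'` define
*inequivalent* absolute values of `E` (an element of `v ∖ v'` has `|·|_v < 1 = |·|_{v'}`).
[folklore] -/
theorem not_isEquiv_of_ne {E : Type*} [Field E] [Algebra K E] {v v' : HeightOneSpectrum (𝓞 K)}
    (hvv' : v ≠ v') {φ : E →ₐ[K] AlgebraicClosure (v.adicCompletion K)}
    {ψ : E →ₐ[K] AlgebraicClosure (v'.adicCompletion K)} {w₁ w₂ : AbsoluteValue E ℝ}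
    (hw₁ : ∀ x, w₁ x =
      spectralNorm (v.adicCompletion K) (AlgebraicClosure (v.adicCompletion K)) (φ x))
    (hw₂ : ∀ x, w₂ x =
      spectralNorm (v'.adicCompletion K) (AlgebraicClosure (v'.adicCompletion K)) (ψ x)) :
    ¬ w₁.IsEquiv w₂ := by
  intro h
  have hle : ¬ v.asIdeal ≤ v'.asIdeal := fun hle =>
    hvv' (HeightOneSpectrum.ext (v.isMaximal.eq_of_le v'.isMaximal.ne_top hle))
  obtain ⟨r, hrv, hrv'⟩ := Set.not_subset.1 hle
  have h1 : w₁ (algebraMap K E (algebraMap (𝓞 K) K r)) < 1 := by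
    rw [absoluteValue_algebraMap_of_forall_eq_spectralNorm hw₁, ← IsScalarTower.algebraMap_apply]
    exact (norm_algebraMap_ringOfIntegers_lt_one_iff K v r).2 hrv
  have h2 : ¬ w₂ (algebraMap K E (algebraMap (𝓞 K) K r)) < 1 := by
    rw [absoluteValue_algebraMap_of_forall_eq_spectralNorm hw₂, ← IsScalarTower.algebraMap_apply,
      norm_algebraMap_ringOfIntegers_lt_one_iff K v' r]
    exact hrv'
  exact h2 (h.lt_one_iff.1 h1)

variable {K v} in
/-- `|φ ·|_v` is inequivalent to any absolute value exceeding `1` on a natural number (e.g. an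
archimedean one): `|n|_v ≤ 1`. [folklore] -/
theorem not_isEquiv_of_one_lt {E : Type*} [Field E] [Algebra K E]
    {φ : E →ₐ[K] AlgebraicClosure (v.adicCompletion K)} {w₁ w₂ : AbsoluteValue E ℝ}
    (hw₁ : ∀ x, w₁ x =
      spectralNorm (v.adicCompletion K) (AlgebraicClosure (v.adicCompletion K)) (φ x))
    {n : ℕ} (hn : 1 < w₂ n) : ¬ w₁.IsEquiv w₂ := by
  intro h
  have h1 : w₁ n ≤ 1 := by
    rw [show (n : E) = algebraMap K E (algebraMap (𝓞 K) K n) by simp,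
      absoluteValue_algebraMap_of_forall_eq_spectralNorm hw₁, ← IsScalarTower.algebraMap_apply]
    exact norm_algebraMap_ringOfIntegers_le_one K v _
  exact (not_lt.2 h1) (h.one_lt_iff.2 hn)

/-- Two real embeddings of a field whose absolute values `|σ ·|`, `|σ' ·|` are equivalent are equal
(distinct real embeddings give distinct infinite places, Mathlib
`NumberField.InfinitePlace.mk_eq_iff`, `eq_iff_isEquiv`). [folklore] -/
theorem ringHom_real_eq_of_isEquiv {E : Type*} [Field E] (σ σ' : E →+* ℝ)
    {w w' : AbsoluteValue E ℝ} (hw : ∀ x, w x = |σ x|) (hw' : ∀ x, w' x = |σ' x|)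
    (h : w.IsEquiv w') : σ = σ' := by
  set φ : E →+* ℂ := Complex.ofRealHom.comp σ with hφ
  set φ' : E →+* ℂ := Complex.ofRealHom.comp σ' with hφ'
  have h1 : (NumberField.InfinitePlace.mk φ).1 = w := by
    ext x
    change (NumberField.InfinitePlace.mk φ) x = w x
    rw [NumberField.InfinitePlace.apply, hw, hφ, RingHom.comp_apply, Complex.ofRealHom_eq_coe,
      Complex.norm_real, Real.norm_eq_abs]
  have h2 : (NumberField.InfinitePlace.mk φ').1 = w' := by
    ext x
    change (NumberField.InfinitePlace.mk φ') x = w' x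
    rw [NumberField.InfinitePlace.apply, hw', hφ', RingHom.comp_apply, Complex.ofRealHom_eq_coe,
      Complex.norm_real, Real.norm_eq_abs]
  have hmk : NumberField.InfinitePlace.mk φ = NumberField.InfinitePlace.mk φ' :=
    NumberField.InfinitePlace.eq_iff_isEquiv.2 (by rw [h1, h2]; exact h)
  rw [NumberField.InfinitePlace.mk_eq_iff] at hmk
  have hreal : NumberField.ComplexEmbedding.conjugate φ = φ := by
    ext x
    simp [hφ, NumberField.ComplexEmbedding.conjugate_coe_eq]
  rw [hreal, or_self] at hmk
  ext x
  have := RingHom.congr_fun hmk x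
  simpa [hφ, hφ'] using this

/-! ### Simultaneous approximation at finitely many finite places and the real places -/

/-- **Simultaneous approximation in `E` at the embeddings into `\bar K_v` (`v ∈ S`) and at the real
embeddings.**  Let `E/K` be a finite extension of number fields, `S` a finite set of finite places
of `K`, `t v φ ∈ E` a target for every `v` and every `K`-embedding `φ : E → \bar K_v`, consistent
in the sense that `t v φ = t v ψ` whenever `φ` and `ψ` define the same absolute value
`|φ ·|_v = |ψ ·|_v` of `E` (`v ∈ S`), and `r σ ∈ E` a target for every real embedding `σ` of `E`.
Then for every `ε > 0` there is `x ∈ E` with `|φ (x - t v φ)|_v < ε` for all `v ∈ S` and all `φ`,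
and `|σ (x - r σ)| < ε` for all real `σ`.  This is the approximation theorem (Artin–Whaples;
Neukirch, *Algebraic Number Theory*, Ch. II (3.4)) for the finitely many pairwise inequivalent
absolute values `{|φ ·|_v} ∪ {|σ ·|}` of `E`, via Mathlib's `AbsoluteValue.denseRange_algebraMap_pi`.
[cite: NeukirchANT1999, Ch. II (3.4)] -/
theorem exists_forall_spectralNorm_sub_lt (E : Type*) [Field E] [Algebra K E]
    [FiniteDimensional K E] (S : Finset (HeightOneSpectrum (𝓞 K)))
    (t : (v : HeightOneSpectrum (𝓞 K)) → (E →ₐ[K] AlgebraicClosure (v.adicCompletion K)) → E)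
    (ht : ∀ v ∈ S, ∀ φ ψ : E →ₐ[K] AlgebraicClosure (v.adicCompletion K),
      (∀ x, spectralNorm (v.adicCompletion K) (AlgebraicClosure (v.adicCompletion K)) (φ x) =
        spectralNorm (v.adicCompletion K) (AlgebraicClosure (v.adicCompletion K)) (ψ x)) →
      t v φ = t v ψ)
    (r : (E →+* ℝ) → E) {ε : ℝ} (hε : 0 < ε) :
    ∃ x : E,
      (∀ v ∈ S, ∀ φ : E →ₐ[K] AlgebraicClosure (v.adicCompletion K),
        spectralNorm (v.adicCompletion K) (AlgebraicClosure (v.adicCompletion K))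
          (φ (x - t v φ)) < ε) ∧
      ∀ σ : E →+* ℝ, |σ (x - r σ)| < ε := by
  classical
  haveI : NumberField E := NumberField.of_module_finite K E
  -- the absolute values of the family
  choose wf hwf using fun (u : HeightOneSpectrum (𝓞 K))
    (φ : E →ₐ[K] AlgebraicClosure (u.adicCompletion K)) =>
      exists_absoluteValue_eq_spectralNorm K u φ
  let wr : (E →+* ℝ) → AbsoluteValue E ℝ := fun σ =>
    (NumberField.InfinitePlace.mk (Complex.ofRealHom.comp σ)).1
  have hwr : ∀ σ x, wr σ x = |σ x| := fun σ x => by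
    change (NumberField.InfinitePlace.mk (Complex.ofRealHom.comp σ)) x = |σ x|
    rw [NumberField.InfinitePlace.apply, RingHom.comp_apply, Complex.ofRealHom_eq_coe,
      Complex.norm_real, Real.norm_eq_abs]
  have hwr2 : ∀ σ, 1 < wr σ (2 : ℕ) := fun σ => by
    rw [hwr, map_natCast]; norm_num
  -- the finite family, as a finset of absolute values
  let P : Finset (Σ u : HeightOneSpectrum (𝓞 K),
      (E →ₐ[K] AlgebraicClosure (u.adicCompletion K))) := S.sigma fun _ => Finset.univ
  let A : Finset (AbsoluteValue E ℝ) :=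
    P.image (fun p => wf p.1 p.2) ∪ Finset.univ.image wr
  have hmemA : ∀ w ∈ A, (∃ u ∈ S, ∃ φ, wf u φ = w) ∨ ∃ σ, wr σ = w := by
    intro w hw
    rcases Finset.mem_union.1 hw with hw | hw
    · obtain ⟨p, hp, rfl⟩ := Finset.mem_image.1 hw
      exact Or.inl ⟨p.1, (Finset.mem_sigma.1 hp).1, p.2, rfl⟩
    · obtain ⟨σ, -, rfl⟩ := Finset.mem_image.1 hw
      exact Or.inr ⟨σ, rfl⟩
  have hmem_f : ∀ u ∈ S, ∀ φ, wf u φ ∈ A := fun u hu φ =>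
    Finset.mem_union_left _ (Finset.mem_image.2 ⟨⟨u, φ⟩, Finset.mem_sigma.2 ⟨hu, Finset.mem_univ _⟩,
      rfl⟩)
  have hmem_r : ∀ σ, wr σ ∈ A := fun σ =>
    Finset.mem_union_right _ (Finset.mem_image.2 ⟨σ, Finset.mem_univ _, rfl⟩)
  -- consistency: equal absolute values in the family have equal targets
  have key_ff : ∀ u ∈ S, ∀ u' ∈ S, ∀ (φ : E →ₐ[K] AlgebraicClosure (u.adicCompletion K))
      (φ' : E →ₐ[K] AlgebraicClosure (u'.adicCompletion K)),
      (wf u φ).IsEquiv (wf u' φ') → wf u φ = wf u' φ' ∧ t u φ = t u' φ' := by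
    intro u hu u' hu' φ φ' h
    by_cases huu : u = u'
    · subst huu
      have heq := eq_of_isEquiv_of_forall_eq_spectralNorm (hwf u φ) (hwf u φ') h
      refine ⟨heq, ht u hu φ φ' fun x => ?_⟩
      rw [← hwf, ← hwf, heq]
    · exact absurd h (not_isEquiv_of_ne huu (hwf u φ) (hwf u' φ'))
  have key_fr : ∀ u (φ : E →ₐ[K] AlgebraicClosure (u.adicCompletion K)) σ,
      ¬ (wf u φ).IsEquiv (wr σ) := fun u φ σ =>
    not_isEquiv_of_one_lt (hwf u φ) (hwr2 σ)
  have key_rr : ∀ σ σ', (wr σ).IsEquiv (wr σ') → σ = σ' := fun σ σ' h =>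
    ringHom_real_eq_of_isEquiv σ σ' (hwr σ) (hwr σ') h
  -- targets, indexed by the absolute values
  have htgt : ∀ i : A, ∃ e : E, (∀ u ∈ S, ∀ φ, wf u φ = i.1 → e = t u φ) ∧
      ∀ σ, wr σ = i.1 → e = r σ := by
    rintro ⟨w, hw⟩
    rcases hmemA w hw with ⟨u₀, hu₀, φ₀, rfl⟩ | ⟨σ₀, rfl⟩
    · refine ⟨t u₀ φ₀, fun u hu φ h => ?_, fun σ h => ?_⟩
      · exact ((key_ff u hu u₀ hu₀ φ φ₀ (h ▸ AbsoluteValue.IsEquiv.refl _)).2).symm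
      · exact absurd (h ▸ AbsoluteValue.IsEquiv.refl _) (key_fr u₀ φ₀ σ)
    · refine ⟨r σ₀, fun u hu φ h => ?_, fun σ h => ?_⟩
      · exact absurd (h ▸ AbsoluteValue.IsEquiv.refl _) (key_fr u φ σ₀)
      · rw [key_rr σ σ₀ (h ▸ AbsoluteValue.IsEquiv.refl _)]
  choose tgt htgt_f htgt_r using htgt
  -- the hypotheses of the approximation theorem
  have hnt : ∀ i : A, (i.1 : AbsoluteValue E ℝ).IsNontrivial := by
    rintro ⟨w, hw⟩
    rcases hmemA w hw with ⟨u₀, -, φ₀, rfl⟩ | ⟨σ₀, rfl⟩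
    · exact isNontrivial_of_forall_eq_spectralNorm (hwf u₀ φ₀)
    · exact NumberField.InfinitePlace.isNontrivial _
  have hpw : Pairwise fun i j : A => ¬ (i.1 : AbsoluteValue E ℝ).IsEquiv j.1 := by
    rintro ⟨w, hw⟩ ⟨w', hw'⟩ hij h
    apply hij
    rw [Subtype.mk.injEq]
    rcases hmemA w hw with ⟨u, hu, φ, rfl⟩ | ⟨σ, rfl⟩ <;>
      rcases hmemA w' hw' with ⟨u', hu', φ', rfl⟩ | ⟨σ', rfl⟩
    · exact (key_ff u hu u' hu' φ φ' h).1
    · exact absurd h (key_fr u φ σ')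
    · exact absurd h.symm (key_fr u' φ' σ)
    · rw [key_rr σ σ' h]
  -- approximate
  let z : (i : A) → WithAbs (i.1 : AbsoluteValue E ℝ) := fun i => WithAbs.toAbs _ (tgt i)
  obtain ⟨x, hx⟩ := (AbsoluteValue.denseRange_algebraMap_pi
    (v := fun i : A => (i.1 : AbsoluteValue E ℝ)) hnt hpw).exists_dist_lt z hε
  have hcomp : ∀ i : A, (i.1 : AbsoluteValue E ℝ) (x - tgt i) < ε := fun i => by
    have hi := (dist_le_pi_dist z (algebraMap E ((i : A) → WithAbs (i.1 : AbsoluteValue E ℝ)) x)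
      i).trans_lt hx
    rw [dist_comm, dist_eq_norm] at hi
    exact hi
  refine ⟨x, fun u hu φ => ?_, fun σ => ?_⟩
  · have h := hcomp ⟨wf u φ, hmem_f u hu φ⟩
    rwa [htgt_f ⟨wf u φ, hmem_f u hu φ⟩ u hu φ rfl, hwf] at h
  · have h := hcomp ⟨wr σ, hmem_r σ⟩
    rwa [htgt_r ⟨wr σ, hmem_r σ⟩ σ rfl, hwr] at h

end Literature.NumberTheory.GaloisRepresentations
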